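import Summits.BirchSwinnertonDyer.BirchSwinnertonDyer.Theorems.ByReductionTypeAtTwoAdditivePotGoodLowerHalfT0ClassLiftF
import Summits.BirchSwinnertonDyer.BirchSwinnertonDyer.Theorems.ByReductionTypeAtTwoAdditivePotGoodLowerHalfT0NarrowRankStampsA
import Summits.BirchSwinnertonDyer.BirchSwinnertonDyer.Theorems.ByReductionTypeAtTwoOrdKatoHalfAtTwoIsoConjATwoOfNarrowRankLayerModels
import HarnessLib

/-!
# K4 crux `AdditiveRankZeroAtTwo` (19098), child C3″ `AdditivePotGoodLowerHalfAtTwo` (item 22617): the GENERAL RUNG `m ≥ 1` of the NARROW RANK CERTIFICATE for the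
# `Δ_cubic > 0` rows `261648q1`, `279440c1` — (A)₂ and the BSD₂ rungs from ONE displayed equality `rank₂ Cl⁺(ℚ(θ)·ℚ_(m+1)) = rank₂ Cl⁺(ℚ(θ)·ℚ_m)`, NO index and NO
# bound (file A of the series `NarrowRankRungRows` A–D; seat `bsd-2adic-k4-w2` GEN 12; `--supports stmt-BirchSwinnertonDyer-22617 --as helper`)

Cell `bsd-2adic`. cruxlead-19573-w2 GEN 11 landed the general rung (p747405 `NarrowRankRung.conjA_two_cubicModel_of_narrowRank_layer_succ_eq p q r hirr hβ m hm hnr κ hκ`: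
for the cubic field `ℚ(β)` — Fukuda index `≤ 1` along every cyclotomic `ℤ₂`-extension — ONE equality of narrow `2`-ranks at ANY consecutive layer pair `(m, m+1)`,
`m ≥ 1`, gives (A)₂; and COMPLETENESS p746869 / p747072: such a rung fires for some `m` iff narrow `μ₂(ℚ(β)) = 0` with bounded narrow defect — the Kida-lite road's
exact price). This file puts it in the census currency of the seven rows (exact change of generator `θ ↔ x(P)` copied from GEN 11's `conjA_two_<L>_of_narrowRankCert`):
§1 `AddKatoTwo.conjA_two_<L>_of_narrowRankEq_succ hθ m hm hnr`; §2 GEN 3's rungs re-keyed `AddPotGoodInstances.bsdp_two_<L>_narrowRankEq_succ`,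
`bsdp_two_of_isIsogenous_<L>_narrowRankEq_succ`. With this file NO further Lean is needed on these rows whatever layer pair the instruments reach: letters
(JUMP01, EQUAL12) ⟶ `m = 1` (= this seat's `…_of_narrowRankEq₁₂`, p745903–05); (JUMP01, JUMP12, EQUAL23) ⟶ `m = 2` (degrees 12/24); and so on.

CENSUS (2026-08-29, two engines: eng-2 `j335966` PARI/bnfcertify and this seat's exact unit arithmetic, memo `CENSUS-22617-k4w2-GEN12.md`): layer-pair `(0,1)` letters
JUMP on `261648q1`, `279440c1`, `293200be1`, `412992bw1`, `467928d1`, `174920h1` (on the five `h⁺ = 1` two-prime fields by the KERNEL theorem of narrow genus theory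
`AmbiguousClass.even_narrowClassNumber_of_quadratic_of_isTotallyReal_of_odd_narrowClassNumber`, p746551 / `not_forall_index_range_pow_two_narrowClassGroup_layer_one_eq_layer_zero`,
p746744), EQUAL on `445508b1` only; the `(1,2)` letters (degree 12, eng-2 `narrow6L2`) are pending at landing time.

HONEST FRAMING (D-0036 / D-0054 / D-0152): conditional theorems; `hnr` is an INSTRUMENT-tier datum, UNVALUED when this file lands; `hSharp` is the Kato-at-`2` SHARP
reading (D-audit PASS). Closes nothing at the `∀`-level (C3″ 22617 / C1″ 22615 OPEN); nothing booked (D-0054); no rung moves; BSD is not proved by any of this.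
THEOREMS ONLY (no `def`).

References: [Fukuda1994] Thm. 1 (2), p. 264; [Washington1997] §13.1 Prop. 13.2, Lemma 13.3; [Kida1982JFields] main theorem (shape); [CoatesSujatha2005] (A), Thm. 3.4;
[Kato2004Asterisque] Thm. 12.5 (1)(3), 13.8, 14.14; [Cassels1965ArithmeticVIII] Thm. 1.3; [Miller2011LMS] Def. 1.1; [Gras2003] IV.4.
-/

set_option autoImplicit false
-- the Theorems namespace of this sub repeats the summit name by design (D-0017 nested layout)
set_option linter.dupNamespace false

noncomputable section

open scoped Classical IntermediateField NumberField Real nonZeroDivisors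

/-! ## §1 The general rung census instances (namespace `AddKatoTwo`) -/

namespace Summit.BirchSwinnertonDyer.BirchSwinnertonDyer.Theorems.AddKatoTwo

open WeierstrassCurve Field Polynomial IsDedekindDomain NumberField Matrix Literature.NumberTheory.EllipticCurves
  Literature.NumberTheory.GaloisRepresentations
  Literature.NumberTheory.IwasawaTheory
  Literature.NumberTheory.NumberFields
  Summit.BirchSwinnertonDyer.BirchSwinnertonDyer.Theorems.SteinbergFibreAtTwo
  Summit.BirchSwinnertonDyer.BirchSwinnertonDyer.Theorems.AlignedTransportAtTwoTorsionPointField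
  Summit.BirchSwinnertonDyer.BirchSwinnertonDyer.Theses.ByReductionTypeAtTwo

/-- **A monic integer cubic with a root `β` of degree `3` is irreducible** (restated to keep this file's imports minimal). [folklore] -/
private theorem irreducibleCubic_of_finrank_three_srrgA {p q r : ℤ} {β : AlgebraicClosure ℚ}
    (hβ : aeval β (Cubic.toPoly ⟨1, (p : ℚ), q, r⟩) = 0) (h3 : Module.finrank ℚ (IntermediateField.adjoin ℚ {β}) = 3) :
    Irreducible (Cubic.toPoly ⟨1, (p : ℚ), q, r⟩) := by
  have hfm : (Cubic.toPoly ⟨1, (p : ℚ), q, r⟩).Monic := Cubic.monic_of_a_eq_one'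
  have hβint : IsIntegral ℚ β := ⟨_, hfm, by rwa [← aeval_def]⟩
  have hdeg : (minpoly ℚ β).natDegree = (Cubic.toPoly ⟨1, (p : ℚ), q, r⟩).natDegree := by
    rw [← IntermediateField.adjoin.finrank hβint, h3, Cubic.natDegree_of_a_ne_zero' one_ne_zero]
  have heq : Cubic.toPoly ⟨1, (p : ℚ), q, r⟩ = minpoly ℚ β :=
    Polynomial.eq_of_monic_of_dvd_of_natDegree_le (minpoly.monic hβint) hfm (minpoly.dvd ℚ β hβ) hdeg.ge
  rw [heq]
  exact minpoly.irreducible hβint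

/-- **(A)₂ for `261648q1` from the GENERAL RUNG `m ≥ 1` of the narrow rank certificate — the census instance at the layers `m / m+1`: ONE displayed equality
`rank₂ Cl⁺(ℚ(θ)·ℚ_(m+1)) = rank₂ Cl⁺(ℚ(θ)·ℚ_m)`** (abstract layers of every cyclotomic `ℤ₂`-extension of `ℚ(θ)`, any `NumberField` instances; concrete fields of
degrees `3·2^m`, `3·2^(m+1)`) — NO index and NO bound displayed (cruxlead-19573-w2 GEN 11 door `NarrowRankRung.conjA_two_cubicModel_of_narrowRank_layer_succ_eq`,
p747405: a cubic field has Fukuda index `≤ 1 ≤ m` along every cyclotomic `ℤ₂`-extension; COMPLETENESS p746869/p747072: some rung fires iff narrow `μ₂ = 0` and the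
narrow defect is bounded). Row data: `d = 316`; letters (0,1) JUMP (two engines 2026-08-29), rung m = 1 pending (degree 12). `m = 1` is this seat's `conjA_two_261648q1_of_narrowRankEq₁₂` (p745903–05); use `m = 2` for letters (JUMP01, JUMP12,
EQUAL23) (degrees 12/24), etc. `θ` is any root of `X³ + (-1)X² + (-4)X + (2)` (`ℚ(θ) = ℚ(x(P))`, exact change of generator as in GEN 11). Instrument tier, UNVALUED
at landing. BSD for `261648q1` is NOT proved by this. [cite: Fukuda1994, Thm. 1 (2), p. 264] [cite: Washington1997, §13.1 and Lemma 13.3] [cite: CoatesSujatha2005, Conj. A and Thm. 3.4] -/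
theorem conjA_two_261648q1_of_narrowRankEq_succ
    {θ : AlgebraicClosure ℚ} (hθ : aeval θ (Cubic.toPoly ⟨1, ((-1 : ℤ) : ℚ), ((-4 : ℤ) : ℚ), ((2 : ℤ) : ℚ)⟩) = 0)
    (m : ℕ) (hm : 1 ≤ m)
    (hnr : haveI : FiniteDimensional ℚ (IntermediateField.adjoin ℚ {θ}) :=
        IntermediateField.adjoin.finiteDimensional ((AlgebraicClosure.isAlgebraic ℚ).isAlgebraic θ).isIntegral
      haveI : NumberField (IntermediateField.adjoin ℚ {θ}) := NumberField.mk
      ∀ κL : ZpExtension (IntermediateField.adjoin ℚ {θ}) 2, κL.IsCyclotomic →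
        ∀ [NumberField ↥(κL.layer m)] [NumberField ↥(κL.layer (m + 1))],
          (powMonoidHom (α := NarrowClassGroup ↥(κL.layer (m + 1))) 2).range.index =
            (powMonoidHom (α := NarrowClassGroup ↥(κL.layer m)) 2).range.index)
    (κ : ZpExtension ℚ 2) (hκ : κ.IsCyclotomic) :
    haveI := (isElliptic_cubicModel _ _ _ (by simp only [Cubic.discr]; norm_num) : (⟨0, ((0 : ℤ) : ℚ), 0, ((-3540805887 : ℤ) : ℚ), ((-81096346959158 : ℤ) : ℚ)⟩ : WeierstrassCurve ℚ).IsElliptic)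
    ∃ (γ : absoluteGaloisGroup ℚ) (D : (⟨0, ((0 : ℤ) : ℚ), 0, ((-3540805887 : ℤ) : ℚ), ((-81096346959158 : ℤ) : ℚ)⟩ : WeierstrassCurve ℚ).FineSelmerDualData κ γ),
      Module.Finite ℤ_[2] (RestrictScalars ℤ_[2] (IwasawaAlgebra 2) D.X) := by
  haveI := (isElliptic_cubicModel _ _ _ (by simp only [Cubic.discr]; norm_num) : (⟨0, ((0 : ℤ) : ℚ), 0, ((-3540805887 : ℤ) : ℚ), ((-81096346959158 : ℤ) : ℚ)⟩ : WeierstrassCurve ℚ).IsElliptic)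
  have hθ' : θ ^ 3 + (-1 : AlgebraicClosure ℚ) * θ ^ 2 + (-4 : AlgebraicClosure ℚ) * θ + (2 : AlgebraicClosure ℚ) = 0 := by
    have := hθ
    simp only [Cubic.toPoly, map_one, one_mul, aeval_add, aeval_mul, aeval_C, aeval_X_pow, aeval_X,
      eq_ratCast, Rat.cast_intCast] at this
    push_cast at this
    linear_combination this
  obtain ⟨β, hβdef⟩ : ∃ β : AlgebraicClosure ℚ, β = algebraMap ℚ (AlgebraicClosure ℚ) (68045 : ℚ) +
      algebraMap ℚ (AlgebraicClosure ℚ) (12756 : ℚ) * θ + algebraMap ℚ (AlgebraicClosure ℚ) (-24099 : ℚ) * θ ^ 2 := ⟨_, rfl⟩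
  have hβ : aeval β (Cubic.toPoly ⟨1, ((0 : ℤ) : ℚ), ((-3540805887 : ℤ) : ℚ), ((-81096346959158 : ℤ) : ℚ)⟩) = 0 := by
    simp only [Cubic.toPoly, map_one, one_mul, aeval_add, aeval_mul, aeval_C, aeval_X_pow, aeval_X, eq_ratCast,
      Rat.cast_intCast]
    rw [hβdef]
    simp only [eq_ratCast]
    push_cast
    linear_combination ((-3486915174474 : AlgebraicClosure ℚ) + (59035664530116 : AlgebraicClosure ℚ) * θ + (8228813958369 : AlgebraicClosure ℚ) * θ ^ 2 + (-13995778642299 : AlgebraicClosure ℚ) * θ ^ 3) * hθ'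
  have hadj : IntermediateField.adjoin ℚ {β} = IntermediateField.adjoin ℚ {θ} := by
    apply le_antisymm
    · rw [IntermediateField.adjoin_simple_le_iff, hβdef]
      have hθmem := IntermediateField.mem_adjoin_simple_self ℚ θ
      exact add_mem (add_mem (algebraMap_mem _ _) (mul_mem (algebraMap_mem _ _) hθmem))
        (mul_mem (algebraMap_mem _ _) (pow_mem hθmem 2))
    · rw [IntermediateField.adjoin_simple_le_iff]
      have hθeq : θ = algebraMap ℚ (AlgebraicClosure ℚ) (-9481097860256 / 109503 : ℚ) +
          algebraMap ℚ (AlgebraicClosure ℚ) (-275974019 / 219006 : ℚ) * β +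
          algebraMap ℚ (AlgebraicClosure ℚ) (8033 / 219006 : ℚ) * β ^ 2 := by
        rw [hβdef]; simp only [eq_ratCast]; push_cast
        linear_combination (((30393200919 : AlgebraicClosure ℚ) / 24334) + ((-518362171937 : AlgebraicClosure ℚ) / 24334) * θ) * hθ'
      rw [hθeq]
      have hβmem := IntermediateField.mem_adjoin_simple_self ℚ β
      exact add_mem (add_mem (algebraMap_mem _ _) (mul_mem (algebraMap_mem _ _) hβmem))
        (mul_mem (algebraMap_mem _ _) (pow_mem hβmem 2))
  haveI : FiniteDimensional ℚ (IntermediateField.adjoin ℚ {θ}) :=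
    IntermediateField.adjoin.finiteDimensional ((AlgebraicClosure.isAlgebraic ℚ).isAlgebraic θ).isIntegral
  haveI : NumberField (IntermediateField.adjoin ℚ {θ}) := NumberField.mk
  have h3 := finrank_adjoin_eq_three_of_irreducible irreducible_cubic_d316p hθ
  have h3β : Module.finrank ℚ (IntermediateField.adjoin ℚ {β}) = 3 := by rw [hadj]; exact h3
  -- transport along `ℚ(β) = ℚ(θ)` by substituting a field VARIABLE (a `rw` on this statement times out at `whnf`)
  have hnr' : ∀ F : IntermediateField ℚ (AlgebraicClosure ℚ), IntermediateField.adjoin ℚ {θ} = F →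
      ∀ κL : ZpExtension ↥F 2, κL.IsCyclotomic →
        ∀ [NumberField ↥(κL.layer m)] [NumberField ↥(κL.layer (m + 1))],
          (powMonoidHom (α := NarrowClassGroup ↥(κL.layer (m + 1))) 2).range.index =
            (powMonoidHom (α := NarrowClassGroup ↥(κL.layer m)) 2).range.index := by
    rintro F rfl; exact fun κL hκL => hnr κL hκL
  haveI : NumberField (IntermediateField.adjoin ℚ {β}) := by rw [hadj]; infer_instance
  exact NarrowRankRung.conjA_two_cubicModel_of_narrowRank_layer_succ_eq (0) (-3540805887) (-81096346959158)
    (irreducibleCubic_of_finrank_three_srrgA hβ h3β) hβ m hm (hnr' _ hadj.symm) κ hκ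

/-- **(A)₂ for `279440c1` from the GENERAL RUNG `m ≥ 1` of the narrow rank certificate — the census instance at the layers `m / m+1`: ONE displayed equality
`rank₂ Cl⁺(ℚ(θ)·ℚ_(m+1)) = rank₂ Cl⁺(ℚ(θ)·ℚ_m)`** (abstract layers of every cyclotomic `ℤ₂`-extension of `ℚ(θ)`, any `NumberField` instances; concrete fields of
degrees `3·2^m`, `3·2^(m+1)`) — NO index and NO bound displayed (cruxlead-19573-w2 GEN 11 door `NarrowRankRung.conjA_two_cubicModel_of_narrowRank_layer_succ_eq`,
p747405: a cubic field has Fukuda index `≤ 1 ≤ m` along every cyclotomic `ℤ₂`-extension; COMPLETENESS p746869/p747072: some rung fires iff narrow `μ₂ = 0` and the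
narrow defect is bounded). Row data: `d = 9980`; letters (0,1) JUMP, rung m = 1 pending. `m = 1` is this seat's `conjA_two_279440c1_of_narrowRankEq₁₂` (p745903–05); use `m = 2` for letters (JUMP01, JUMP12,
EQUAL23) (degrees 12/24), etc. `θ` is any root of `X³ + (-1)X² + (-36)X + (-70)` (`ℚ(θ) = ℚ(x(P))`, exact change of generator as in GEN 11). Instrument tier, UNVALUED
at landing. BSD for `279440c1` is NOT proved by this. [cite: Fukuda1994, Thm. 1 (2), p. 264] [cite: Washington1997, §13.1 and Lemma 13.3] [cite: CoatesSujatha2005, Conj. A and Thm. 3.4] -/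
theorem conjA_two_279440c1_of_narrowRankEq_succ
    {θ : AlgebraicClosure ℚ} (hθ : aeval θ (Cubic.toPoly ⟨1, ((-1 : ℤ) : ℚ), ((-36 : ℤ) : ℚ), ((-70 : ℤ) : ℚ)⟩) = 0)
    (m : ℕ) (hm : 1 ≤ m)
    (hnr : haveI : FiniteDimensional ℚ (IntermediateField.adjoin ℚ {θ}) :=
        IntermediateField.adjoin.finiteDimensional ((AlgebraicClosure.isAlgebraic ℚ).isAlgebraic θ).isIntegral
      haveI : NumberField (IntermediateField.adjoin ℚ {θ}) := NumberField.mk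
      ∀ κL : ZpExtension (IntermediateField.adjoin ℚ {θ}) 2, κL.IsCyclotomic →
        ∀ [NumberField ↥(κL.layer m)] [NumberField ↥(κL.layer (m + 1))],
          (powMonoidHom (α := NarrowClassGroup ↥(κL.layer (m + 1))) 2).range.index =
            (powMonoidHom (α := NarrowClassGroup ↥(κL.layer m)) 2).range.index)
    (κ : ZpExtension ℚ 2) (hκ : κ.IsCyclotomic) :
    haveI := (isElliptic_cubicModel _ _ _ (by simp only [Cubic.discr]; norm_num) : (⟨0, ((1 : ℤ) : ℚ), 0, ((-114041197436 : ℤ) : ℚ), ((-14823196533966296 : ℤ) : ℚ)⟩ : WeierstrassCurve ℚ).IsElliptic)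
    ∃ (γ : absoluteGaloisGroup ℚ) (D : (⟨0, ((1 : ℤ) : ℚ), 0, ((-114041197436 : ℤ) : ℚ), ((-14823196533966296 : ℤ) : ℚ)⟩ : WeierstrassCurve ℚ).FineSelmerDualData κ γ),
      Module.Finite ℤ_[2] (RestrictScalars ℤ_[2] (IwasawaAlgebra 2) D.X) := by
  haveI := (isElliptic_cubicModel _ _ _ (by simp only [Cubic.discr]; norm_num) : (⟨0, ((1 : ℤ) : ℚ), 0, ((-114041197436 : ℤ) : ℚ), ((-14823196533966296 : ℤ) : ℚ)⟩ : WeierstrassCurve ℚ).IsElliptic)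
  have hθ' : θ ^ 3 + (-1 : AlgebraicClosure ℚ) * θ ^ 2 + (-36 : AlgebraicClosure ℚ) * θ + (-70 : AlgebraicClosure ℚ) = 0 := by
    have := hθ
    simp only [Cubic.toPoly, map_one, one_mul, aeval_add, aeval_mul, aeval_C, aeval_X_pow, aeval_X,
      eq_ratCast, Rat.cast_intCast] at this
    push_cast at this
    linear_combination this
  obtain ⟨β, hβdef⟩ : ∃ β : AlgebraicClosure ℚ, β = algebraMap ℚ (AlgebraicClosure ℚ) (1470966 : ℚ) +
      algebraMap ℚ (AlgebraicClosure ℚ) (233916 : ℚ) * θ + algebraMap ℚ (AlgebraicClosure ℚ) (-63655 : ℚ) * θ ^ 2 := ⟨_, rfl⟩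
  have hβ : aeval β (Cubic.toPoly ⟨1, ((1 : ℤ) : ℚ), ((-114041197436 : ℤ) : ℚ), ((-14823196533966296 : ℤ) : ℚ)⟩) = 0 := by
    simp only [Cubic.toPoly, map_one, one_mul, aeval_add, aeval_mul, aeval_C, aeval_X_pow, aeval_X, eq_ratCast,
      Rat.cast_intCast]
    rw [hβdef]
    simp only [eq_ratCast]
    push_cast
    linear_combination ((-42860252107125034 : AlgebraicClosure ℚ) + (732050685724260 : AlgebraicClosure ℚ) * θ + (2585526690139325 : AlgebraicClosure ℚ) * θ ^ 2 + (-257927451736375 : AlgebraicClosure ℚ) * θ ^ 3) * hθ'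
  have hadj : IntermediateField.adjoin ℚ {β} = IntermediateField.adjoin ℚ {θ} := by
    apply le_antisymm
    · rw [IntermediateField.adjoin_simple_le_iff, hβdef]
      have hθmem := IntermediateField.mem_adjoin_simple_self ℚ θ
      exact add_mem (add_mem (algebraMap_mem _ _) (mul_mem (algebraMap_mem _ _) hθmem))
        (mul_mem (algebraMap_mem _ _) (pow_mem hθmem 2))
    · rw [IntermediateField.adjoin_simple_le_iff]
      have hθeq : θ = algebraMap ℚ (AlgebraicClosure ℚ) (49383642969422 / 1977326743 : ℚ) +
          algebraMap ℚ (AlgebraicClosure ℚ) (12409348439 / 193778020814 : ℚ) * β +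
          algebraMap ℚ (AlgebraicClosure ℚ) (-63655 / 193778020814 : ℚ) * β ^ 2 := by
        rw [hβdef]; simp only [eq_ratCast]; push_cast
        linear_combination (((-1637708642847425 : AlgebraicClosure ℚ) / 193778020814) + ((257927451736375 : AlgebraicClosure ℚ) / 193778020814) * θ) * hθ'
      rw [hθeq]
      have hβmem := IntermediateField.mem_adjoin_simple_self ℚ β
      exact add_mem (add_mem (algebraMap_mem _ _) (mul_mem (algebraMap_mem _ _) hβmem))
        (mul_mem (algebraMap_mem _ _) (pow_mem hβmem 2))
  haveI : FiniteDimensional ℚ (IntermediateField.adjoin ℚ {θ}) :=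
    IntermediateField.adjoin.finiteDimensional ((AlgebraicClosure.isAlgebraic ℚ).isAlgebraic θ).isIntegral
  haveI : NumberField (IntermediateField.adjoin ℚ {θ}) := NumberField.mk
  have h3 := finrank_adjoin_eq_three_of_irreducible irreducible_cubic_d9980p hθ
  have h3β : Module.finrank ℚ (IntermediateField.adjoin ℚ {β}) = 3 := by rw [hadj]; exact h3
  -- transport along `ℚ(β) = ℚ(θ)` by substituting a field VARIABLE (a `rw` on this statement times out at `whnf`)
  have hnr' : ∀ F : IntermediateField ℚ (AlgebraicClosure ℚ), IntermediateField.adjoin ℚ {θ} = F →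
      ∀ κL : ZpExtension ↥F 2, κL.IsCyclotomic →
        ∀ [NumberField ↥(κL.layer m)] [NumberField ↥(κL.layer (m + 1))],
          (powMonoidHom (α := NarrowClassGroup ↥(κL.layer (m + 1))) 2).range.index =
            (powMonoidHom (α := NarrowClassGroup ↥(κL.layer m)) 2).range.index := by
    rintro F rfl; exact fun κL hκL => hnr κL hκL
  haveI : NumberField (IntermediateField.adjoin ℚ {β}) := by rw [hadj]; infer_instance
  exact NarrowRankRung.conjA_two_cubicModel_of_narrowRank_layer_succ_eq (1) (-114041197436) (-14823196533966296)
    (irreducibleCubic_of_finrank_three_srrgA hβ h3β) hβ m hm (hnr' _ hadj.symm) κ hκ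

end Summit.BirchSwinnertonDyer.BirchSwinnertonDyer.Theorems.AddKatoTwo

/-! ## §2 The C3″ rungs (namespace `AddPotGoodInstances`) -/

namespace Summit.BirchSwinnertonDyer.BirchSwinnertonDyer.Theorems.AddPotGoodInstances

open WeierstrassCurve Polynomial Literature.NumberTheory.EllipticCurves
  Literature.NumberTheory.IwasawaTheory
  Literature.NumberTheory.NumberFields
  Literature.NumberTheory.EllipticCurves.Rank1Residual
  Literature.NumberTheory.EllipticCurves.Rank1Residual.Typed
  Summit.BirchSwinnertonDyer.Rank1Residual
  Summit.BirchSwinnertonDyer.Rank1Residual.Additive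
  Summit.BirchSwinnertonDyer.BirchSwinnertonDyer.Theorems

/-- Model transport for (A) at `2` in the `∃ γ D` spelling (the statement only depends on the Weierstrass CURVE).
[cite: CoatesSujatha2005, statement (A)] -/
private theorem conjA_two_of_eq'' {W W' : WeierstrassCurve ℚ} (h : W' = W)
    (H : ∀ (κ : ZpExtension ℚ 2), κ.IsCyclotomic →
      ∃ (γ : Field.absoluteGaloisGroup ℚ) (D : W'.FineSelmerDualData κ γ), Module.Finite ℤ_[2] (RestrictScalars ℤ_[2] (IwasawaAlgebra 2) D.X)) :
    ∀ (κ : ZpExtension ℚ 2), κ.IsCyclotomic →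
      ∃ (γ : Field.absoluteGaloisGroup ℚ) (D : W.FineSelmerDualData κ γ), Module.Finite ℤ_[2] (RestrictScalars ℤ_[2] (IwasawaAlgebra 2) D.X) := by
  subst h; exact H

/-! ## Row `261648q1` (Δ_cubic > 0; stamp `AddKatoTwo.conjA_two_261648q1_of_narrowRankEq_succ` of §1) -/

/-- **(A) at `(261648q1, 2)` for the Cremona model from ONE displayed narrow-rank equality at the layers `m / m+1` (`m ≥ 1`), NO print fact**: §1's stamp
transported from its cast model to the literal model. [cite: CoatesSujatha2005, statement (A)] -/
theorem conjA_two_261648q1_of_narrowRankEq_succ_kernelLit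
    {θ : AlgebraicClosure ℚ} (hθ : aeval θ (Cubic.toPoly ⟨1, ((-1 : ℤ) : ℚ), ((-4 : ℤ) : ℚ), ((2 : ℤ) : ℚ)⟩) = 0)
    (m : ℕ) (hm : 1 ≤ m)
    (hnr : haveI : FiniteDimensional ℚ (IntermediateField.adjoin ℚ {θ}) :=
        IntermediateField.adjoin.finiteDimensional ((AlgebraicClosure.isAlgebraic ℚ).isAlgebraic θ).isIntegral
      haveI : NumberField (IntermediateField.adjoin ℚ {θ}) := NumberField.mk
      ∀ κL : ZpExtension (IntermediateField.adjoin ℚ {θ}) 2, κL.IsCyclotomic →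
        ∀ [NumberField ↥(κL.layer m)] [NumberField ↥(κL.layer (m + 1))],
          (powMonoidHom (α := NarrowClassGroup ↥(κL.layer (m + 1))) 2).range.index =
            (powMonoidHom (α := NarrowClassGroup ↥(κL.layer m)) 2).range.index)
    :
    haveI := isElliptic_261648q1
    ∀ (κ : ZpExtension ℚ 2), κ.IsCyclotomic →
      ∃ (γ : Field.absoluteGaloisGroup ℚ) (D : (⟨0, 0, 0, -3540805887, -81096346959158⟩ : WeierstrassCurve ℚ).FineSelmerDualData κ γ),
        Module.Finite ℤ_[2] (RestrictScalars ℤ_[2] (IwasawaAlgebra 2) D.X) :=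
  conjA_two_of_eq'' (W' := (⟨0, ((0 : ℤ) : ℚ), 0, ((-3540805887 : ℤ) : ℚ), ((-81096346959158 : ℤ) : ℚ)⟩ : WeierstrassCurve ℚ)) (by norm_num) (fun κ hκ ↦ AddKatoTwo.conjA_two_261648q1_of_narrowRankEq_succ hθ m hm hnr κ hκ)

/-- **`BSD₂(261648q1)` with (A) from ONE displayed narrow-rank equality at the layers `m / m+1` (`m ≥ 1`) and NO print fact for (A)**: GEN 3's rung
`bsdp_two_261648q1_of_conjA` with `hA` from `conjA_two_261648q1_of_narrowRankEq_succ_kernelLit hθ m hm hnr`. Conditional on PRINT {`hSharp` (reading), `hGZK`, `hmod`, `hCT`},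
the RECORD `hr`, `#Ш_an = q` (bounded `ord₂ q`), the two VALUED slots and the (unvalued) instrument equality `hnr`. Nothing booked; BSD is not proved by this.
[cite: Kato2004Asterisque, Thm. 12.5 (1)(3), 13.8, 14.14] [cite: Fukuda1994, Thm. 1 (2)] [cite: Miller2011LMS, Def. 1.1] -/
theorem bsdp_two_261648q1_narrowRankEq_succ
    (hSharp : Kato2004.rankZero_padicValNat_sha_add_padicValNat_tamagawa_le_at_two_of_irreducible_of_fineSelmerDual_fg)
    (hGZK : rank_eq_analyticRank_of_analyticRank_le_one) (hmod : hasEntireLFunction_rat)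
    (hCT : exists_casselsTate_pairing (K := ℚ))
    {θ : AlgebraicClosure ℚ} (hθ : aeval θ (Cubic.toPoly ⟨1, ((-1 : ℤ) : ℚ), ((-4 : ℤ) : ℚ), ((2 : ℤ) : ℚ)⟩) = 0)
    (m : ℕ) (hm : 1 ≤ m)
    (hnr : haveI : FiniteDimensional ℚ (IntermediateField.adjoin ℚ {θ}) :=
        IntermediateField.adjoin.finiteDimensional ((AlgebraicClosure.isAlgebraic ℚ).isAlgebraic θ).isIntegral
      haveI : NumberField (IntermediateField.adjoin ℚ {θ}) := NumberField.mk
      ∀ κL : ZpExtension (IntermediateField.adjoin ℚ {θ}) 2, κL.IsCyclotomic →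
        ∀ [NumberField ↥(κL.layer m)] [NumberField ↥(κL.layer (m + 1))],
          (powMonoidHom (α := NarrowClassGroup ↥(κL.layer (m + 1))) 2).range.index =
            (powMonoidHom (α := NarrowClassGroup ↥(κL.layer m)) 2).range.index)
    (hr : haveI := isElliptic_261648q1; (⟨0, 0, 0, -3540805887, -81096346959158⟩ : WeierstrassCurve ℚ).analyticRank = 0)
    (hs₁ : Nat.card ((⟨0, 0, 0, -3540805887, -81096346959158⟩ : WeierstrassCurve ℚ).selmerGroup (2 ^ 2)) = 2 ^ 4)
    (hs₂ : Nat.card ((⟨0, 0, 0, -3540805887, -81096346959158⟩ : WeierstrassCurve ℚ).selmerGroup (2 ^ (2 + 1))) = 2 ^ 6)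
    {q : ℚ} (hq : haveI := isElliptic_261648q1; shaAn (⟨0, 0, 0, -3540805887, -81096346959158⟩ : WeierstrassCurve ℚ) = (q : ℂ)) (hv : padicValRat 2 q ≤ 6) :
    haveI := isElliptic_261648q1; haveI := isGloballyMinimal_261648q1
    BSDp (⟨0, 0, 0, -3540805887, -81096346959158⟩ : WeierstrassCurve ℚ) 2 := by
  exact bsdp_two_261648q1_of_conjA hSharp hGZK hmod hCT (conjA_two_261648q1_of_narrowRankEq_succ_kernelLit hθ m hm hnr) hr hs₁ hs₂ hq hv

/-- **`BSD₂` ON THE WHOLE CLASS of `261648q1` with (A) from ONE displayed narrow-rank equality at the layers `m / m+1` (`m ≥ 1`) and NO print fact for (A)**: GEN 3's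
class rung (Cassels transport `hCassels`) with `hA` from `conjA_two_261648q1_of_narrowRankEq_succ_kernelLit hθ m hm hnr`. Nothing booked; BSD is not proved by this.
[cite: Cassels1965ArithmeticVIII, Thm. 1.3] [cite: Kato2004Asterisque, Thm. 12.5 (1)(3)] [cite: Fukuda1994, Thm. 1 (2)] -/
theorem bsdp_two_of_isIsogenous_261648q1_narrowRankEq_succ
    (hSharp : Kato2004.rankZero_padicValNat_sha_add_padicValNat_tamagawa_le_at_two_of_irreducible_of_fineSelmerDual_fg)
    (hGZK : rank_eq_analyticRank_of_analyticRank_le_one) (hmod : hasEntireLFunction_rat)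
    (hCT : exists_casselsTate_pairing (K := ℚ)) (hCassels : bsdRHS_eq_of_isIsogenous)
    {θ : AlgebraicClosure ℚ} (hθ : aeval θ (Cubic.toPoly ⟨1, ((-1 : ℤ) : ℚ), ((-4 : ℤ) : ℚ), ((2 : ℤ) : ℚ)⟩) = 0)
    (m : ℕ) (hm : 1 ≤ m)
    (hnr : haveI : FiniteDimensional ℚ (IntermediateField.adjoin ℚ {θ}) :=
        IntermediateField.adjoin.finiteDimensional ((AlgebraicClosure.isAlgebraic ℚ).isAlgebraic θ).isIntegral
      haveI : NumberField (IntermediateField.adjoin ℚ {θ}) := NumberField.mk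
      ∀ κL : ZpExtension (IntermediateField.adjoin ℚ {θ}) 2, κL.IsCyclotomic →
        ∀ [NumberField ↥(κL.layer m)] [NumberField ↥(κL.layer (m + 1))],
          (powMonoidHom (α := NarrowClassGroup ↥(κL.layer (m + 1))) 2).range.index =
            (powMonoidHom (α := NarrowClassGroup ↥(κL.layer m)) 2).range.index)
    {W : WeierstrassCurve ℚ} [W.IsElliptic] [W.IsGloballyMinimal]
    (hiso : haveI := isElliptic_261648q1; IsIsogenous W (⟨0, 0, 0, -3540805887, -81096346959158⟩ : WeierstrassCurve ℚ)) (hr : W.analyticRank = 0)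
    (hs₁ : Nat.card ((⟨0, 0, 0, -3540805887, -81096346959158⟩ : WeierstrassCurve ℚ).selmerGroup (2 ^ 2)) = 2 ^ 4)
    (hs₂ : Nat.card ((⟨0, 0, 0, -3540805887, -81096346959158⟩ : WeierstrassCurve ℚ).selmerGroup (2 ^ (2 + 1))) = 2 ^ 6)
    {q : ℚ} (hq : haveI := isElliptic_261648q1; shaAn (⟨0, 0, 0, -3540805887, -81096346959158⟩ : WeierstrassCurve ℚ) = (q : ℂ)) (hv : padicValRat 2 q ≤ 6) :
    BSDp W 2 := by
  exact bsdp_two_of_isIsogenous_261648q1_of_conjA hSharp hGZK hmod hCT hCassels (conjA_two_261648q1_of_narrowRankEq_succ_kernelLit hθ m hm hnr) hiso hr hs₁ hs₂ hq hv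

/-! ## Row `279440c1` (Δ_cubic > 0; stamp `AddKatoTwo.conjA_two_279440c1_of_narrowRankEq_succ` of §1) -/

/-- **(A) at `(279440c1, 2)` for the Cremona model from ONE displayed narrow-rank equality at the layers `m / m+1` (`m ≥ 1`), NO print fact**: §1's stamp
transported from its cast model to the literal model. [cite: CoatesSujatha2005, statement (A)] -/
theorem conjA_two_279440c1_of_narrowRankEq_succ_kernelLit
    {θ : AlgebraicClosure ℚ} (hθ : aeval θ (Cubic.toPoly ⟨1, ((-1 : ℤ) : ℚ), ((-36 : ℤ) : ℚ), ((-70 : ℤ) : ℚ)⟩) = 0)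
    (m : ℕ) (hm : 1 ≤ m)
    (hnr : haveI : FiniteDimensional ℚ (IntermediateField.adjoin ℚ {θ}) :=
        IntermediateField.adjoin.finiteDimensional ((AlgebraicClosure.isAlgebraic ℚ).isAlgebraic θ).isIntegral
      haveI : NumberField (IntermediateField.adjoin ℚ {θ}) := NumberField.mk
      ∀ κL : ZpExtension (IntermediateField.adjoin ℚ {θ}) 2, κL.IsCyclotomic →
        ∀ [NumberField ↥(κL.layer m)] [NumberField ↥(κL.layer (m + 1))],
          (powMonoidHom (α := NarrowClassGroup ↥(κL.layer (m + 1))) 2).range.index =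
            (powMonoidHom (α := NarrowClassGroup ↥(κL.layer m)) 2).range.index)
    :
    haveI := isElliptic_279440c1
    ∀ (κ : ZpExtension ℚ 2), κ.IsCyclotomic →
      ∃ (γ : Field.absoluteGaloisGroup ℚ) (D : (⟨0, 1, 0, -114041197436, -14823196533966296⟩ : WeierstrassCurve ℚ).FineSelmerDualData κ γ),
        Module.Finite ℤ_[2] (RestrictScalars ℤ_[2] (IwasawaAlgebra 2) D.X) :=
  conjA_two_of_eq'' (W' := (⟨0, ((1 : ℤ) : ℚ), 0, ((-114041197436 : ℤ) : ℚ), ((-14823196533966296 : ℤ) : ℚ)⟩ : WeierstrassCurve ℚ)) (by norm_num) (fun κ hκ ↦ AddKatoTwo.conjA_two_279440c1_of_narrowRankEq_succ hθ m hm hnr κ hκ)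

/-- **`BSD₂(279440c1)` with (A) from ONE displayed narrow-rank equality at the layers `m / m+1` (`m ≥ 1`) and NO print fact for (A)**: GEN 3's rung
`bsdp_two_279440c1_of_conjA` with `hA` from `conjA_two_279440c1_of_narrowRankEq_succ_kernelLit hθ m hm hnr`. Conditional on PRINT {`hSharp` (reading), `hGZK`, `hmod`, `hCT`},
the RECORD `hr`, `#Ш_an = q` (bounded `ord₂ q`), the two VALUED slots and the (unvalued) instrument equality `hnr`. Nothing booked; BSD is not proved by this.
[cite: Kato2004Asterisque, Thm. 12.5 (1)(3), 13.8, 14.14] [cite: Fukuda1994, Thm. 1 (2)] [cite: Miller2011LMS, Def. 1.1] -/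
theorem bsdp_two_279440c1_narrowRankEq_succ
    (hSharp : Kato2004.rankZero_padicValNat_sha_add_padicValNat_tamagawa_le_at_two_of_irreducible_of_fineSelmerDual_fg)
    (hGZK : rank_eq_analyticRank_of_analyticRank_le_one) (hmod : hasEntireLFunction_rat)
    (hCT : exists_casselsTate_pairing (K := ℚ))
    {θ : AlgebraicClosure ℚ} (hθ : aeval θ (Cubic.toPoly ⟨1, ((-1 : ℤ) : ℚ), ((-36 : ℤ) : ℚ), ((-70 : ℤ) : ℚ)⟩) = 0)
    (m : ℕ) (hm : 1 ≤ m)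
    (hnr : haveI : FiniteDimensional ℚ (IntermediateField.adjoin ℚ {θ}) :=
        IntermediateField.adjoin.finiteDimensional ((AlgebraicClosure.isAlgebraic ℚ).isAlgebraic θ).isIntegral
      haveI : NumberField (IntermediateField.adjoin ℚ {θ}) := NumberField.mk
      ∀ κL : ZpExtension (IntermediateField.adjoin ℚ {θ}) 2, κL.IsCyclotomic →
        ∀ [NumberField ↥(κL.layer m)] [NumberField ↥(κL.layer (m + 1))],
          (powMonoidHom (α := NarrowClassGroup ↥(κL.layer (m + 1))) 2).range.index =
            (powMonoidHom (α := NarrowClassGroup ↥(κL.layer m)) 2).range.index)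
    (hr : haveI := isElliptic_279440c1; (⟨0, 1, 0, -114041197436, -14823196533966296⟩ : WeierstrassCurve ℚ).analyticRank = 0)
    (hs₁ : Nat.card ((⟨0, 1, 0, -114041197436, -14823196533966296⟩ : WeierstrassCurve ℚ).selmerGroup (2 ^ 2)) = 2 ^ 4)
    (hs₂ : Nat.card ((⟨0, 1, 0, -114041197436, -14823196533966296⟩ : WeierstrassCurve ℚ).selmerGroup (2 ^ (2 + 1))) = 2 ^ 6)
    {q : ℚ} (hq : haveI := isElliptic_279440c1; shaAn (⟨0, 1, 0, -114041197436, -14823196533966296⟩ : WeierstrassCurve ℚ) = (q : ℂ)) (hv : padicValRat 2 q ≤ 6) :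
    haveI := isElliptic_279440c1; haveI := isGloballyMinimal_279440c1
    BSDp (⟨0, 1, 0, -114041197436, -14823196533966296⟩ : WeierstrassCurve ℚ) 2 := by
  exact bsdp_two_279440c1_of_conjA hSharp hGZK hmod hCT (conjA_two_279440c1_of_narrowRankEq_succ_kernelLit hθ m hm hnr) hr hs₁ hs₂ hq hv

/-- **`BSD₂` ON THE WHOLE CLASS of `279440c1` with (A) from ONE displayed narrow-rank equality at the layers `m / m+1` (`m ≥ 1`) and NO print fact for (A)**: GEN 3's
class rung (Cassels transport `hCassels`) with `hA` from `conjA_two_279440c1_of_narrowRankEq_succ_kernelLit hθ m hm hnr`. Nothing booked; BSD is not proved by this.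
[cite: Cassels1965ArithmeticVIII, Thm. 1.3] [cite: Kato2004Asterisque, Thm. 12.5 (1)(3)] [cite: Fukuda1994, Thm. 1 (2)] -/
theorem bsdp_two_of_isIsogenous_279440c1_narrowRankEq_succ
    (hSharp : Kato2004.rankZero_padicValNat_sha_add_padicValNat_tamagawa_le_at_two_of_irreducible_of_fineSelmerDual_fg)
    (hGZK : rank_eq_analyticRank_of_analyticRank_le_one) (hmod : hasEntireLFunction_rat)
    (hCT : exists_casselsTate_pairing (K := ℚ)) (hCassels : bsdRHS_eq_of_isIsogenous)
    {θ : AlgebraicClosure ℚ} (hθ : aeval θ (Cubic.toPoly ⟨1, ((-1 : ℤ) : ℚ), ((-36 : ℤ) : ℚ), ((-70 : ℤ) : ℚ)⟩) = 0)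
    (m : ℕ) (hm : 1 ≤ m)
    (hnr : haveI : FiniteDimensional ℚ (IntermediateField.adjoin ℚ {θ}) :=
        IntermediateField.adjoin.finiteDimensional ((AlgebraicClosure.isAlgebraic ℚ).isAlgebraic θ).isIntegral
      haveI : NumberField (IntermediateField.adjoin ℚ {θ}) := NumberField.mk
      ∀ κL : ZpExtension (IntermediateField.adjoin ℚ {θ}) 2, κL.IsCyclotomic →
        ∀ [NumberField ↥(κL.layer m)] [NumberField ↥(κL.layer (m + 1))],
          (powMonoidHom (α := NarrowClassGroup ↥(κL.layer (m + 1))) 2).range.index =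
            (powMonoidHom (α := NarrowClassGroup ↥(κL.layer m)) 2).range.index)
    {W : WeierstrassCurve ℚ} [W.IsElliptic] [W.IsGloballyMinimal]
    (hiso : haveI := isElliptic_279440c1; IsIsogenous W (⟨0, 1, 0, -114041197436, -14823196533966296⟩ : WeierstrassCurve ℚ)) (hr : W.analyticRank = 0)
    (hs₁ : Nat.card ((⟨0, 1, 0, -114041197436, -14823196533966296⟩ : WeierstrassCurve ℚ).selmerGroup (2 ^ 2)) = 2 ^ 4)
    (hs₂ : Nat.card ((⟨0, 1, 0, -114041197436, -14823196533966296⟩ : WeierstrassCurve ℚ).selmerGroup (2 ^ (2 + 1))) = 2 ^ 6)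
    {q : ℚ} (hq : haveI := isElliptic_279440c1; shaAn (⟨0, 1, 0, -114041197436, -14823196533966296⟩ : WeierstrassCurve ℚ) = (q : ℂ)) (hv : padicValRat 2 q ≤ 6) :
    BSDp W 2 := by
  exact bsdp_two_of_isIsogenous_279440c1_of_conjA hSharp hGZK hmod hCT hCassels (conjA_two_279440c1_of_narrowRankEq_succ_kernelLit hθ m hm hnr) hiso hr hs₁ hs₂ hq hv

end Summit.BirchSwinnertonDyer.BirchSwinnertonDyer.Theorems.AddPotGoodInstances

end
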